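import Literature.Topology.FourManifolds.CodimTwoNormalEuler
import Literature.Topology.FourManifolds.FramedCodimTwoBounds
import Literature.Topology.FourManifolds.ImmersionCriterion
import HarnessLib

/-!
# Closed oriented codimension-two submanifolds of spheres bound (Kirby, Ch. VIII, Thms. 2 and 3)

Topic `Literature/Topology/FourManifolds`; assembly file of the generalisation of the tree's 2-knot
pipeline to abstract manifolds (`SphereImmersionNormalField.lean`, `CodimTwoNormalPartner.lean`,
`SphereEmbeddingNormalTube.lean`, `CodimTwoNormalEuler.lean`), for the fact seat
`Literature.Topology.FourManifolds.isOrientedBordant_of_isEmpty_of_signature_eq_zero` (Kirby's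
Cor. IX.2: `σ : Ω₄^{SO} → ℤ` is injective).

R. C. Kirby, *The Topology of 4-Manifolds* (LNM 1374, 1989), Ch. VIII:

* **Thm. 2** (p. 44): an oriented `Mᵐ` smoothly embedded in an oriented `Q^{m+2}` with
  `[M] = 0 ∈ H_m(Q; ℤ)` has trivial normal bundle — for `Q = S^{m+2}` this is
  `exists_isNormalFraming_two_of_embedding` (`CodimTwoNormalEuler.lean`), repackaged here through
  the tree's tubular neighbourhood theorem (`nonempty_framedTubularEmbedding_of_isNormalFraming`,
  `PontryaginThomCollapse.lean`) as a `Literature.Topology.FourManifolds.FramedTubularEmbedding`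
  (`exists_framedTubularEmbedding_of_embedding`);
* **Thm. 3** (pp. 44–45): such an `M` bounds an oriented Seifert manifold `W^{m+1} ⊆ Q` — the
  tree's `FramedTubularEmbedding.exists_nullCobordism_smoothOrientation` (`FramedCodimTwoBounds.lean`).

Together (proved here): **every closed connected smoothly oriented `n`-manifold (`n ≥ 1`) which
embeds smoothly in `S^{n+2}` bounds a compact smoothly oriented `(n+1)`-manifold**
(`exists_nullCobordism_smoothOrientation_of_embedding`); in dimension `4` it is an oriented
boundary for every `ℤ`-orientation (`isOrientedBordant_of_isEmpty_of_embedding`). Consequently the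
residual hypothesis of the fact's reduction
`isOrientedBordant_of_isEmpty_of_signature_eq_zero_of_framedEmbedding` (`FramedCodimTwoBounds.lean`:
"every simply connected closed smooth `ℤ`-oriented 4-manifold of signature zero is oriented-bordant
to a connected closed 4-manifold with a framed tubular embedding of codimension two into `S⁶`")
weakens to a plain smooth embedding into `S⁶` of a smoothly oriented bordant manifold
(`isOrientedBordant_of_isEmpty_of_signature_eq_zero_of_embedding`): what remains of Kirby's proof of
VIII Thm. 1 (A) are exactly the immersion-theoretic steps `W₂`, `W₃` (pp. 46–49: `M₁ ↬ ℝ⁶` with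
algebraically zero triple points, the 1-handle bordism cancelling the triple points and the
bordism removing the double curves, ending with `M₃` embedded in `ℝ⁶ ⊆ S⁶`).

Everything here is proved; no named facts are introduced (D-0026).

## References

* R. C. Kirby, *The Topology of 4-Manifolds*, LNM 1374, Springer (1989), Ch. VIII, Thms. 2, 3 and
  the proof of Thm. 1 (A), pp. 44–49; Ch. IX, Cor. 2. [Kirby1989]
* M. W. Hirsch, *Differential Topology*, GTM 33 (1976), Ch. 4 §5 (tubular neighbourhoods), Ch. 1
  §3 Thm. 3.1 (injective immersions of compact manifolds are embeddings). [HirschDT1976]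
-/

open scoped Manifold ContDiff Topology
open Set Function Module
open Literature.AlgebraicTopology.SingularHomology

noncomputable section

namespace Literature.Topology.FourManifolds

universe u

/-- Local notation: `𝔼 n` is the model Euclidean space `EuclideanSpace ℝ (Fin n)`. -/
local notation "𝔼 " n:arg => EuclideanSpace ℝ (Fin n)

/-- Local notation: `𝕊 n` is the unit sphere in `EuclideanSpace ℝ (Fin (n + 1))`. -/
local notation "𝕊 " n:arg => (Metric.sphere (0 : EuclideanSpace ℝ (Fin (n + 1))) 1)

attribute [local instance] fact_finrank_euclideanSpace_succ

/-- **Kirby's Thm. VIII.2 for `Q = S^{n+2}`, packaged as a framed tubular embedding**: a smooth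
embedding `f : M → 𝕊ⁿ⁺²` (smooth, injective, injective differentials) of a compact smoothly oriented
`n`-manifold is the core of a framed tubular embedding `M × ℝ² ↪ 𝕊ⁿ⁺²` (tree's
`FramedTubularEmbedding n 2 M`) — the normal `2`-framing of `exists_isNormalFraming_two_of_embedding`
thickened by the tubular neighbourhood theorem. [cite: Kirby1989, Ch. VIII Thm. 2] -/
theorem exists_framedTubularEmbedding_of_embedding {n : ℕ} {M : Type*} [TopologicalSpace M]
    [ChartedSpace (𝔼 n) M] [IsManifold (𝓡 n) ∞ M] [CompactSpace M] [T2Space M]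
    (o : SmoothOrientation (𝓡 n) M) {f : M → 𝕊 (n + 2)} (hf : ContMDiff (𝓡 n) (𝓡 (n + 2)) ∞ f)
    (hf' : ∀ x, Injective (mfderiv (𝓡 n) (𝓡 (n + 2)) f x)) (hinj : Injective f) :
    ∃ E : FramedTubularEmbedding n 2 M, E.emb = f := by
  obtain ⟨fr, hfr⟩ := exists_isNormalFraming_two_of_embedding o hf hf' hinj
  have hemb : Manifold.IsSmoothEmbedding (𝓡 n) (𝓡 (n + 2)) ∞ f :=
    isSmoothEmbedding_of_injective_of_injective_mfderiv hf (by simp) hinj hf'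
  exact nonempty_framedTubularEmbedding_of_isNormalFraming hemb hfr

/-- **Closed connected oriented codimension-two submanifolds of spheres bound** (Kirby, Ch. VIII,
Thm. 2 with Thm. 3): a closed connected smoothly oriented `n`-manifold `M` (`n ≥ 1`) with a smooth
embedding into `S^{n+2}` is the boundary of a compact smooth `(n+1)`-manifold carrying a smooth
orientation (tree's `NullCobordism` and `SmoothOrientation (𝓡∂ (n + 1))`).
[cite: Kirby1989, Ch. VIII Thms. 2–3] -/
theorem exists_nullCobordism_smoothOrientation_of_embedding {n : ℕ} {M : Type} [TopologicalSpace M]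
    [T2Space M] [ChartedSpace (𝔼 n) M] [CompactSpace M] [IsManifold (𝓡 n) ∞ M] [ConnectedSpace M]
    (o : SmoothOrientation (𝓡 n) M) {f : M → 𝕊 (n + 2)} (hf : ContMDiff (𝓡 n) (𝓡 (n + 2)) ∞ f)
    (hf' : ∀ x, Injective (mfderiv (𝓡 n) (𝓡 (n + 2)) f x)) (hinj : Injective f) (hn : 1 ≤ n) :
    ∃ c : NullCobordism.{0} n M, Nonempty (SmoothOrientation (𝓡∂ (n + 1)) c.W) := by
  obtain ⟨E, -⟩ := exists_framedTubularEmbedding_of_embedding o hf hf' hinj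
  exact E.exists_nullCobordism_smoothOrientation hn

/-- **A connected closed smoothly oriented 4-manifold embedded in `S⁶` is an oriented boundary**: for
any `ℤ`-orientation `μ` of such an `M` and any orientation `ν` of an empty `N`, `(M, μ)` is
oriented-bordant to `(N, ν)`. [cite: Kirby1989, Ch. VIII Thms. 2–3 with the proof of Thm. 1 (p. 46, `W₄`)] -/
theorem isOrientedBordant_of_isEmpty_of_embedding {M : Type} [TopologicalSpace M] [T2Space M]
    [ChartedSpace (𝔼 4) M] [CompactSpace M] [IsManifold (𝓡 4) ∞ M] [ConnectedSpace M]
    (o : SmoothOrientation (𝓡 4) M) {f : M → 𝕊 (4 + 2)} (hf : ContMDiff (𝓡 4) (𝓡 (4 + 2)) ∞ f)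
    (hf' : ∀ x, Injective (mfderiv (𝓡 4) (𝓡 (4 + 2)) f x)) (hinj : Injective f)
    (μ : HomologicalOrientation ℤ M 4)
    {N : Type} [TopologicalSpace N] [T2Space N] [ChartedSpace (𝔼 4) N] [CompactSpace N]
    [IsEmpty N] (ν : HomologicalOrientation ℤ N 4) : IsOrientedBordant 4 μ ν := by
  obtain ⟨E, -⟩ := exists_framedTubularEmbedding_of_embedding o hf hf' hinj
  exact E.isOrientedBordant_of_isEmpty μ ν

/-- **Kirby's Cor. IX.2 (`σ : Ω₄^{SO} → ℤ` is injective: the named fact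
`isOrientedBordant_of_isEmpty_of_signature_eq_zero`, in every universe) follows from the
immersion-theoretic steps `W₂`, `W₃` of Kirby's proof of VIII Thm. 1 (A)** (pp. 46–49): *every
simply connected closed smooth `ℤ`-oriented 4-manifold of signature zero is oriented-bordant to a
connected closed smoothly oriented 4-manifold which embeds smoothly in `S⁶`* (the hypothesis
`hcore`; Kirby: `M₁ ↬ ℝ⁶` with algebraically zero triple points by `p₁ = 3σ = 0` and Lemmas VI.1,
VI.5, then the bordisms `W₂` (Lemma 5, cancelling triple points) and `W₃` (Lemma 6, removing the
double curves) to an embedded `M₃ ⊆ ℝ⁶ ⊆ S⁶`). Given that, the fact follows from the formalised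
steps `W₁` (surgery to `π₁ = 0`), VIII Thm. 2 (`exists_framedTubularEmbedding_of_embedding`) and
`W₄` (VIII Thm. 3, the Seifert hypersurface), composing the bordisms
(`isOrientedBordant_of_isEmpty_of_signature_eq_zero_of_framedEmbedding`).
[cite: Kirby1989, Ch. VIII, proof of Thm. 1 (A), pp. 46–49; Ch. IX Cor. 2] -/
theorem isOrientedBordant_of_isEmpty_of_signature_eq_zero_of_embedding
    (hcore : ∀ (M : Type) [TopologicalSpace M] [T2Space M] [SecondCountableTopology M]
      [ChartedSpace (𝔼 4) M] [CompactSpace M] [IsManifold (𝓡 4) ∞ M] [SimplyConnectedSpace M]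
      (μ : HomologicalOrientation ℤ M 4), μ.signature = 0 →
      ∃ (M₃ : Type) (_ : TopologicalSpace M₃) (_ : T2Space M₃) (_ : SecondCountableTopology M₃)
        (_ : ChartedSpace (𝔼 4) M₃) (_ : IsManifold (𝓡 4) ∞ M₃) (_ : CompactSpace M₃)
        (_ : ConnectedSpace M₃) (_ : SmoothOrientation (𝓡 4) M₃) (μ₃ : HomologicalOrientation ℤ M₃ 4)
        (e : M₃ → 𝕊 (4 + 2)), ContMDiff (𝓡 4) (𝓡 (4 + 2)) ∞ e ∧ Injective e ∧
          (∀ x, Injective (mfderiv (𝓡 4) (𝓡 (4 + 2)) e x)) ∧ IsOrientedBordant 4 μ μ₃) :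
    isOrientedBordant_of_isEmpty_of_signature_eq_zero.{u} := by
  refine isOrientedBordant_of_isEmpty_of_signature_eq_zero_of_framedEmbedding
    fun M _ _ _ _ _ _ _ μ hμ => ?_
  obtain ⟨M₃, i₁, i₂, i₃, i₄, i₅, i₆, i₇, o₃, μ₃, e, he, hinj, he', hb⟩ := hcore M μ hμ
  obtain ⟨E, -⟩ := exists_framedTubularEmbedding_of_embedding o₃ he he' hinj
  exact ⟨M₃, i₁, i₂, i₃, i₄, i₅, i₆, i₇, μ₃, E, hb⟩

end Literature.Topology.FourManifolds
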